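import Mathlib

/-!
# The bordered determinant (Cauchy) expansion (crux `BeyondHessianNs`)

Helper file for crux item stmt-ValiantsHypothesis-5641 (`RefutationDegree.BeyondHessianNs`),
stub `stub_borderedDet` of the line `Sketch`.

For a square matrix `B` of size `k + 1` over a commutative ring, write it in block form
`B = [[s, rᵀ], [c, M]]` with corner `s = B 0 0`, first row `r j = B 0 j.succ`, first column
`c i = B i.succ 0` and lower-right block `M = B.submatrix Fin.succ Fin.succ`. Then

`det B = s * det M - rᵀ * adj M * c = s * det M - Σ_{i,j} r_j * (adj M)_{j i} * c_i`.

Proof: Laplace expansion of `det B` along column `0` (`Matrix.det_succ_column_zero`); the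
`i = 0` term is `s * det M`, and for `i = i'.succ` the minor `det (B.submatrix i'.succ.succAbove
Fin.succ)` is expanded along its row `0` (`Matrix.det_succ_row_zero`), whose entries are the
`r j` and whose minors are the minors `det (M.submatrix i'.succAbove j.succAbove)` of `M`
(`Fin.succ_succAbove_succ`); these are the adjugate entries `(adj M)_{j i'}` up to the sign
`(-1)^(i' + j)` (`Matrix.adjugate_fin_succ_eq_det_submatrix`).
-/

noncomputable section

-- single-conjunct layout: Sub = Summit, duplicated namespace component intended
set_option linter.dupNamespace false

namespace Summit.ValiantsHypothesis.ValiantsHypothesis.Theorems.RefutationDegreeBeyondHessianNs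

open Matrix

/-- Row-`0` Laplace expansion of the minor of `B` obtained by deleting row `i.succ` and
column `0`: its row `0` is the first row `j ↦ B 0 j.succ` of `B` and its minors are the
minors of the lower-right block `B.submatrix Fin.succ Fin.succ` with row `i` deleted.
[folklore] -/
theorem det_submatrix_succ_succAbove_succ {R : Type} [CommRing R] {k : ℕ}
    (B : Matrix (Fin (k + 1 + 1)) (Fin (k + 1 + 1)) R) (i : Fin (k + 1)) :
    (B.submatrix i.succ.succAbove Fin.succ).det =
      ∑ j : Fin (k + 1), (-1) ^ (j : ℕ) * B 0 j.succ *
        ((B.submatrix Fin.succ Fin.succ).submatrix i.succAbove j.succAbove).det := by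
  rw [Matrix.det_succ_row_zero]
  refine Finset.sum_congr rfl fun j _ => ?_
  have h : (i.succ.succAbove ∘ Fin.succ : Fin k → Fin (k + 1 + 1)) =
      Fin.succ ∘ i.succAbove :=
    funext fun a => Fin.succ_succAbove_succ i a
  simp [Matrix.submatrix_submatrix, h]

/-- **Bordered determinant (Cauchy) formula.** For a square matrix `B` of size `k + 1` over a
commutative ring, with corner `B 0 0`, first row `j ↦ B 0 j.succ`, first column
`i ↦ B i.succ 0` and lower-right block `M = B.submatrix Fin.succ Fin.succ`,
`det B = B 0 0 * det M - Σ_{i j} B 0 j.succ * (adj M) j i * B i.succ 0`,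
i.e. `det [[s, rᵀ], [c, M]] = s * det M - rᵀ * adj M * c`. [folklore] -/
theorem stub_borderedDet : ∀ (R : Type) [CommRing R] (k : ℕ) (B : Matrix (Fin (k + 1)) (Fin (k + 1)) R), B.det = B 0 0 * (B.submatrix Fin.succ Fin.succ).det - ∑ i : Fin k, ∑ j : Fin k, B 0 j.succ * (B.submatrix Fin.succ Fin.succ).adjugate j i * B i.succ 0 := by
  intro R _ k B
  rw [Matrix.det_succ_column_zero B, Fin.sum_univ_succ, sub_eq_add_neg, ← Finset.sum_neg_distrib]
  congr 1
  · simp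
  · refine Finset.sum_congr rfl fun i _ => ?_
    cases k with
    | zero => exact i.elim0
    | succ k =>
      rw [det_submatrix_succ_succAbove_succ B i, Finset.mul_sum, ← Finset.sum_neg_distrib]
      refine Finset.sum_congr rfl fun j _ => ?_
      rw [Matrix.adjugate_fin_succ_eq_det_submatrix, Fin.val_succ]
      ring

end Summit.ValiantsHypothesis.ValiantsHypothesis.Theorems.RefutationDegreeBeyondHessianNs
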